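import Summits.BirchSwinnertonDyer.BirchSwinnertonDyer.Theorems.EisensteinPrimesGoodLatticeResidualPairDeterminant
import Summits.BirchSwinnertonDyer.BirchSwinnertonDyer.Theorems.EisensteinPrimesGoodLatticeMuLambdaSplit
import Literature.NumberTheory.EllipticCurves.HeegnerPointsKolyvaginConjugation
import Literature.NumberTheory.EllipticCurves.SelmerCorankProofs
import HarnessLib

/-!
# Route `EisensteinPrimes` (rung K5), crux 2 `GoodLatticeBDPValue`, line `halves`: preliminaries on
# the ω-branch character `θ_sub = ω̃` of the good lattice (helper for stmt-BirchSwinnertonDyer-19032)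

Cell `bsd-eis`, seat `bsd-eis-k5-c2` (gen 7). Three elementary inputs of the joint [BR𝟙]+[BRω]
theorem of road R-ψ (HOME/k5-c2-MEMO-6.md ADDENDUM; HOME/k5-ty-g8/BR-OMEGA-ROAD.md §2):

* `isUnramifiedAt_of_isTeichmullerLiftOn` — Néron–Ogg–Shafarevich for the SUB character: the
  Teichmüller lift of the character of `Γ_K` on a line `Φ ≤ E[p]` of order `p` is unramified at every
  place `w ∤ p` of good reduction (Silverman VII.4.1(a): inertia acts trivially on `E[p]`); and its
  base-change form `isUnramifiedAt_subChar_of_conductorNorm_mul_notMem` for `W/ℚ` at `u ∤ N·p`.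
* `restrictField_ne_one_of_isTeichmullerLiftOn` — if `E(K)` has no `p`-torsion then `θ_sub|_{Γ_K} ≠ 𝟙`
  (else `Γ_K` fixes a point of `Φ`, which descends to `E(K)[p]` by Galois descent
  `WeierstrassCurve.exists_toGeomPoints_eq_of_forall_smul_eq`, Silverman VIII.1).
* `eq_or_eq_of_natCast_mem` — under the Heegner hypothesis for `p` (two primes of `𝓞_K` over `p`),
  every place above `p` is `v` or `v̄`.

HONEST FRAMING: elementary, unconditional; closes nothing by itself (`--supports`). References:
[SilvermanAEC2009] VII.4.1(a), VIII.1; [KellerYin2024] §1.4 (L1063–1086); [GrossLMS1991] §1.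
-/

set_option autoImplicit false
set_option linter.dupNamespace false

noncomputable section

open scoped Classical

open WeierstrassCurve NumberField IsDedekindDomain Field
  Literature.NumberTheory.EllipticCurves Literature.NumberTheory.GaloisRepresentations
  Literature.NumberTheory.EllipticCurves.KellerYin2024 Literature.NumberTheory.EllipticCurves.Rank1Residual

namespace Summit.BirchSwinnertonDyer.BirchSwinnertonDyer.Theorems.EisensteinPrimesMuLambda

/-! ## §1 Néron–Ogg–Shafarevich for the sub character `θ_sub` -/

section SubUnramified

variable {K : Type} [Field K] [NumberField K] (WK : WeierstrassCurve K) [WK.IsElliptic]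
  {p : ℕ} [hp : Fact p.Prime] (S : Set (PadicAlgCl p))

/-- **[LOC] away from `p` for the SUB character `ω̃`.** For an elliptic curve `E/K`, a subgroup
`Φ ≤ E[p]` of order `p`, and `θ : Γ_K → GL₁(𝓞)` the Teichmüller lift of the character of `Γ_K` on `Φ`
(`IsTeichmullerLiftOn S Φ θ`): at every finite place `w ∤ p` of good reduction `θ` is UNRAMIFIED
(`I_𝔓` fixes `E[p]` pointwise, Silverman VII.4.1(a), so the scalar `a ≡ θ(σ)` of `σ ∈ I_𝔓` on a
generator of `Φ` is `≡ 1 (mod p)`, and the Teichmüller lift of `1` is `1`).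
[cite: SilvermanAEC2009, Prop. VII.4.1(a)] [cite: KellerYin2024, §1.4 (arXiv:2402.12781v2 TeX L1063–1086)] -/
theorem isUnramifiedAt_of_isTeichmullerLiftOn {Φ : AddSubgroup (geomPoints WK)} (hcard : Nat.card Φ = p)
    (hle : Φ ≤ geomTorsion WK (p : ℤ)) {θ : FramedGaloisRep K (padicCoeffIntegers S) 1}
    (hθ : IsTeichmullerLiftOn S Φ θ) {w : HeightOneSpectrum (𝓞 K)} (hw : WK.HasGoodReductionAt w)
    (hpw : ((p : ℕ) : 𝓞 K) ∉ w.asIdeal) : θ.IsUnramifiedAt w := by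
  intro 𝔓 h𝔓 σ hσ
  obtain ⟨a, ha, hΦ⟩ := hθ.exists_smul_eq σ
  obtain ⟨P, hP, hP0⟩ := exists_ne_zero_of_card_eq WK (N := p) hcard
  -- `σ ∈ I_𝔓` fixes `P`, so `(a - 1) • P = 0` and `p ∣ a - 1`
  have hPp : (p : ℤ) • P = 0 := (mem_geomTorsion_iff WK _ P).mp (hle hP)
  have hfix : σ • P = P :=
    WK.smul_eq_of_mem_inertia_of_zsmul_eq_zero hw (n := (p : ℤ)) (by exact_mod_cast hpw) h𝔓 hσ hPp
  have ha1 : (a - 1) • P = 0 := by rw [sub_smul, one_smul, ← hΦ P hP, hfix, sub_self]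
  have hord : addOrderOf P = p := by
    rw [natCast_zsmul] at hPp
    rcases (Nat.dvd_prime hp.out).mp (addOrderOf_dvd_of_nsmul_eq_zero hPp) with h1 | h
    · exact absurd (AddMonoid.addOrderOf_eq_one_iff.mp h1) hP0
    · exact h
  have hdvd : (p : ℤ) ∣ a - 1 := by
    rw [← hord]
    exact addOrderOf_dvd_iff_zsmul_eq_zero.mpr ha1
  -- `‖θ(σ) - 1‖ < 1`, `θ(σ)^{p-1} = 1`, hence `θ(σ) = 1`
  have ha1' : ‖(a : PadicAlgCl p) - 1‖ < 1 := by
    rw [show (a : PadicAlgCl p) - 1 = (((a - 1 : ℤ) : ℚ_[p]) : PadicAlgCl p) by push_cast; rfl,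
      PadicAlgCl.norm_extends]
    exact Padic.norm_intCast_lt_one_iff.mpr hdvd
  have he1 : ‖((entry S θ σ : padicCoeffIntegers S) : PadicAlgCl p) - 1‖ < 1 := by
    have e : ((entry S θ σ : padicCoeffIntegers S) : PadicAlgCl p) - 1 =
        (((entry S θ σ : padicCoeffIntegers S) : PadicAlgCl p) - a) + ((a : PadicAlgCl p) - 1) := by ring
    rw [e]
    exact (IsUltrametricDist.norm_add_le_max _ _).trans_lt (max_lt ha ha1')
  have hpow : ((entry S θ σ : padicCoeffIntegers S) : PadicAlgCl p) ^ (p - 1) = 1 := by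
    have h := congrArg ((↑) : padicCoeffIntegers S → PadicAlgCl p)
      (entry_pow_eq_one_of_pow_eq_one S θ σ (hθ.1 σ))
    push_cast at h
    exact h
  exact apply_eq_one_of_entry_eq_one S θ σ (Subtype.ext (eq_one_of_pow_eq_one_of_norm_sub_one_lt_one hpow he1))

end SubUnramified

section SubUnramifiedRat

variable (W : WeierstrassCurve ℚ) [W.IsElliptic] {p : ℕ} [hp : Fact p.Prime] (S : Set (PadicAlgCl p))

/-- **`ω̃` is unramified at every `u ∤ N·p`** for `W/ℚ` of conductor `N` (good reduction off `N`,
`hasGoodReductionAt_of_conductorNorm_notMem`, and §1). In particular `ω̃` is unramified at almost every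
place (`eventually_isUnramifiedAt_of_forall_not_mem`). [cite: SilvermanAEC2009, Prop. VII.4.1(a), Thm. VII.7.1] -/
theorem isUnramifiedAt_subChar_of_conductorNorm_mul_notMem {Φ : AddSubgroup (geomPoints W)}
    (hcard : Nat.card Φ = p) (hle : Φ ≤ geomTorsion W (p : ℤ))
    {θ : FramedGaloisRep ℚ (padicCoeffIntegers S) 1} (hθ : IsTeichmullerLiftOn S Φ θ)
    (u : HeightOneSpectrum (𝓞 ℚ)) (hu : (((W.conductorNorm ℤ * p : ℕ) : ℤ) : 𝓞 ℚ) ∉ u.asIdeal) :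
    θ.IsUnramifiedAt u := by
  have hN : ((W.conductorNorm ℤ : ℤ) : 𝓞 ℚ) ∉ u.asIdeal := fun h ↦ hu (by
    push_cast
    exact u.asIdeal.mul_mem_right _ (by exact_mod_cast h))
  have hpu : ((p : ℕ) : 𝓞 ℚ) ∉ u.asIdeal := fun h ↦ hu (by
    push_cast
    exact u.asIdeal.mul_mem_left _ (by exact_mod_cast h))
  exact isUnramifiedAt_of_isTeichmullerLiftOn W S hcard hle hθ
    (hasGoodReductionAt_of_conductorNorm_notMem W u hN) hpu

end SubUnramifiedRat

/-! ## §2 `θ_sub|_{Γ_K} ≠ 𝟙` when `E(K)[p] = 0` -/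

section SubNontrivial

variable (W : WeierstrassCurve ℚ) {p : ℕ} [hp : Fact p.Prime] (S : Set (PadicAlgCl p))
  {K : Type} [Field K] [NumberField K]

/-- **`ω̃|_{Γ_K} ≠ 𝟙` if `E(K)` has no `p`-torsion.** If the Teichmüller lift `θ` of the character of
`Γ_ℚ` on a line `Φ ≤ E[p]` of order `p` were trivial on `Γ_K`, every `σ ∈ Γ_K` would act on `Φ` by a
scalar `≡ 1 (mod p)`, i.e. fix `Φ` pointwise; a non-zero point of `Φ`, transported to `E(K̄)`
(`pointsEquiv`, `Γ_K`-equivariant), is then `Γ_K`-fixed, hence `K`-rational (Galois descent,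
`WeierstrassCurve.exists_toGeomPoints_eq_of_forall_smul_eq`) — a non-zero point of `E(K)[p]`.
[cite: SilvermanAEC2009, VIII.§1 (proof of Prop. 1.2)] [cite: KellerYin2024, §1.4 (arXiv:2402.12781v2 TeX L1063–1086)] -/
theorem restrictField_ne_one_of_isTeichmullerLiftOn
    (hEK : ∀ Q : (W.baseChange K).toAffine.Point, p • Q = 0 → Q = 0)
    {Φ : AddSubgroup (geomPoints W)} (hcard : Nat.card Φ = p) (hle : Φ ≤ geomTorsion W (p : ℤ))
    {θ : FramedGaloisRep ℚ (padicCoeffIntegers S) 1} (hθ : IsTeichmullerLiftOn S Φ θ) :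
    ∃ σ : absoluteGaloisGroup K, θ.restrictField K σ ≠ 1 := by
  by_contra hall
  push Not at hall
  obtain ⟨P₀, hP₀, hP₀0⟩ := exists_ne_zero_of_card_eq W (N := p) hcard
  have hPp : (p : ℤ) • P₀ = 0 := (mem_geomTorsion_iff W _ P₀).mp (hle hP₀)
  -- every `g ∈ Γ_K` fixes `P₀`
  have hfix : ∀ g : absoluteGaloisGroup K, absGaloisRestrict ℚ K g • P₀ = P₀ := by
    intro g
    obtain ⟨a, ha, hΦ⟩ := hθ.exists_smul_eq (absGaloisRestrict ℚ K g)
    have h1 : θ (absGaloisRestrict ℚ K g) = 1 := by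
      rw [← FramedGaloisRep.restrictField_apply]; exact hall g
    have he : ((entry S θ (absGaloisRestrict ℚ K g) : padicCoeffIntegers S) : PadicAlgCl p) = 1 := by
      rw [entry_eq_one_of_apply_eq_one S θ h1, OneMemClass.coe_one]
    rw [he, ← norm_neg, neg_sub, show (a : PadicAlgCl p) - 1 = (((a - 1 : ℤ) : ℚ_[p]) : PadicAlgCl p) by
      push_cast; rfl, PadicAlgCl.norm_extends, Padic.norm_intCast_lt_one_iff] at ha
    obtain ⟨c, hc⟩ := ha
    rw [hΦ P₀ hP₀, show a = 1 + c * (p : ℤ) by rw [mul_comm, ← hc]; ring, add_smul, one_smul, mul_smul,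
      hPp, smul_zero, add_zero]
  -- transport to `E(K̄)` and descend to `E(K)`
  set Q : geomPoints (W.baseChange K) := RatClosure.pointsEquiv (K := K) W P₀ with hQ
  have hQfix : ∀ g : absoluteGaloisGroup K, g • Q = Q := fun g ↦ by
    rw [hQ, ← RatClosure.pointsEquiv_smul, hfix g]
  obtain ⟨P, hP⟩ := (W.baseChange K).exists_toGeomPoints_eq_of_forall_smul_eq hQfix
  have hPp' : p • P = 0 := by
    apply WeierstrassCurve.toGeomPoints_injective (W.baseChange K)
    rw [map_nsmul, hP, map_zero, hQ, ← map_nsmul, ← natCast_zsmul, hPp, map_zero]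
  have hP0 : P = 0 := hEK P hPp'
  have hQ0 : Q = 0 := by rw [← hP, hP0, map_zero]
  exact hP₀0 ((RatClosure.pointsEquiv (K := K) W).injective (by rw [← hQ, hQ0, map_zero]))

end SubNontrivial

/-! ## §3 Places above a Heegner-split `p` -/

section TwoPrimes

variable {K : Type} [Field K] {p : ℕ} [hp : Fact p.Prime]

/-- A place of `K` containing `p` lies over `(p)`. [folklore] -/
theorem asIdeal_mem_primesOver_of_natCast_mem {w : HeightOneSpectrum (𝓞 K)}
    (hw : ((p : ℕ) : 𝓞 K) ∈ w.asIdeal) :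
    w.asIdeal ∈ (Ideal.span {(p : ℤ)}).primesOver (𝓞 K) := by
  refine ⟨w.isPrime, ⟨?_⟩⟩
  have hmax : (Ideal.span {(p : ℤ)}).IsMaximal :=
    ((Ideal.span_singleton_prime (Int.natCast_ne_zero.mpr hp.out.ne_zero)).mpr
      (Nat.prime_iff_prime_int.mp hp.out)).isMaximal
      (by simpa using Int.natCast_ne_zero.mpr hp.out.ne_zero)
  refine hmax.eq_of_le (Ideal.IsPrime.ne_top inferInstance) ?_
  rw [Ideal.span_le, Set.singleton_subset_iff, SetLike.mem_coe, Ideal.under_def, Ideal.mem_comap,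
    eq_intCast]
  exact_mod_cast hw

/-- **Under the Heegner hypothesis for `p`, the places above `p` are `v` and `v̄`**: `(p)` has exactly
two primes in `𝓞_K` (`SatisfiesHeegnerHypothesis p K`), and `v ≠ v̄` both lie above it.
[cite: GrossLMS1991, §1 (p. 235) (Heegner hypothesis)] -/
theorem eq_or_eq_of_natCast_mem (hHp : SatisfiesHeegnerHypothesis p K)
    {v vbar : HeightOneSpectrum (𝓞 K)} (hv : ((p : ℕ) : 𝓞 K) ∈ v.asIdeal)
    (hvbar : ((p : ℕ) : 𝓞 K) ∈ vbar.asIdeal) (hne : vbar ≠ v) {w : HeightOneSpectrum (𝓞 K)}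
    (hw : ((p : ℕ) : 𝓞 K) ∈ w.asIdeal) : w = v ∨ w = vbar := by
  set T := (Ideal.span {(p : ℤ)}).primesOver (𝓞 K) with hT
  have hcard : T.ncard = 2 := hHp p hp.out dvd_rfl
  have hfin : T.Finite := Set.finite_of_ncard_ne_zero (by rw [hcard]; norm_num)
  by_contra h
  push Not at h
  have hne' : v.asIdeal ≠ vbar.asIdeal := fun e ↦ hne (HeightOneSpectrum.ext e.symm)
  have hwv : w.asIdeal ≠ v.asIdeal := fun e ↦ h.1 (HeightOneSpectrum.ext e)
  have hwvbar : w.asIdeal ≠ vbar.asIdeal := fun e ↦ h.2 (HeightOneSpectrum.ext e)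
  have hsub : ({v.asIdeal, vbar.asIdeal, w.asIdeal} : Set (Ideal (𝓞 K))) ⊆ T := by
    intro x hx
    rcases hx with rfl | rfl | rfl
    · exact asIdeal_mem_primesOver_of_natCast_mem hv
    · exact asIdeal_mem_primesOver_of_natCast_mem hvbar
    · exact asIdeal_mem_primesOver_of_natCast_mem hw
  have h3 : ({v.asIdeal, vbar.asIdeal, w.asIdeal} : Set (Ideal (𝓞 K))).ncard = 3 := by
    rw [Set.ncard_insert_of_notMem (by simp [hne', hwv.symm]) (by simp),
      Set.ncard_pair hwvbar.symm]
  have hle := Set.ncard_le_ncard hsub hfin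
  rw [h3, hcard] at hle
  omega

end TwoPrimes

end Summit.BirchSwinnertonDyer.BirchSwinnertonDyer.Theorems.EisensteinPrimesMuLambda

end
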